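import Mathlib.Analysis.Calculus.FDeriv.Add
import Mathlib.Analysis.Calculus.FDeriv.Equiv
import Literature.Analysis.FluidPDE.VectorCalculus
import HarnessLib

/-!
# Crux `OddMorawetz.MorawetzKillsTypeI` (stmt-NavierStokesRegularity-1377), line `birth`:
  STUB `stub_reflect_divFree`, the spatial reflection preserves incompressibility

The spatial reflection `P v (x) := -v(-x)` of a vector field `v : E → E` (used by the lead's skeleton to
kill every even derivative weight `k` of a Morawetz certificate by parity) preserves pointwise
incompressibility: if `div v = 0` everywhere then `div (P v) = 0` everywhere
(`Literature.Analysis.FluidPDE.VectorCalculus.IsDivFree`, the trace of the Fréchet derivative).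

Proof. The Fréchet derivative of the reflected field is `D(P v)(x) = Dv(-x)` EXACTLY, for every `v` and
with no differentiability hypothesis (`fderiv_reflect`): writing `P v = -(v ∘ N)` with `N = (x ↦ -x)` the
continuous linear equivalence `ContinuousLinearEquiv.neg ℝ`, Mathlib's unconditional `fderiv_fun_neg` and
`ContinuousLinearEquiv.comp_right_fderiv` give `D(P v)(x) = -(Dv(-x) ∘ N)`, and `-(A ∘ N) = A` for every
continuous linear `A` (the two signs cancel; both sides are the junk `0` when `v` is not differentiable at
`-x`). Taking traces, `div (P v)(x) = div v(-x)` (`divergence_reflect`), whence the claim.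

Elementary (chain rule); no named facts, no new definitions.
Lands `--supports stmt-NavierStokesRegularity-1377`.
-/

noncomputable section

-- the problem namespace `Summit.NavierStokesRegularity.NavierStokesRegularity` repeats the summit name by design (D-0017)
set_option linter.dupNamespace false

namespace Summit.NavierStokesRegularity.NavierStokesRegularity.Theorems

open Literature.Analysis Literature.Analysis.FluidPDE

/-- **Chain rule for the spatial reflection.** For every map `v : E → F` between real normed spaces
and every point `x`, the Fréchet derivative of the reflected map `y ↦ -v(-y)` at `x` is the Fréchet
derivative of `v` at `-x`: `D(-v(-·))(x) = Dv(-x)` (the inner sign `h ↦ -h` and the outer sign cancel).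
Unconditional: when `v` is not differentiable at `-x` both sides are the junk value `0`
(Mathlib's `fderiv_fun_neg` and `ContinuousLinearEquiv.comp_right_fderiv` are hypothesis-free). -/
theorem fderiv_reflect {E F : Type*} [NormedAddCommGroup E] [NormedSpace ℝ E] [NormedAddCommGroup F]
    [NormedSpace ℝ F] (v : E → F) (x : E) :
    fderiv ℝ (fun y => -v (-y)) x = fderiv ℝ v (-x) := by
  have h1 : (fun y => -v (-y)) = fun y => -((v ∘ ⇑(ContinuousLinearEquiv.neg ℝ : E ≃L[ℝ] E)) y) :=
    rfl
  rw [h1, fderiv_fun_neg, ContinuousLinearEquiv.comp_right_fderiv]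
  ext h
  simp

/-- **The divergence of the reflected field.** For every vector field `v : E → E` on a real inner
product space and every point `x`, `div (-v(-·))(x) = div v(-x)`: the divergence is the trace of the
Fréchet derivative (`VectorCalculus.divergence`) and `D(-v(-·))(x) = Dv(-x)` (`fderiv_reflect`).
Unconditional in `v`. -/
theorem divergence_reflect {E : Type*} [NormedAddCommGroup E] [InnerProductSpace ℝ E] (v : E → E)
    (x : E) :
    VectorCalculus.divergence (fun y => -v (-y)) x = VectorCalculus.divergence v (-x) := by
  unfold VectorCalculus.divergence
  rw [fderiv_reflect]

/-- **Stub `stub_reflect_divFree`** (crux `OddMorawetz.MorawetzKillsTypeI`, stmt-NavierStokesRegularity-1377,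
line `birth`). The spatial reflection `P v (x) = -v(-x)` preserves pointwise incompressibility on `ℝ³`:
if `v` is divergence free (`VectorCalculus.IsDivFree v`, i.e. `div v (x) = 0` for all `x`) then so is
`x ↦ -v(-x)`, because `div (P v)(x) = div v(-x)` (`divergence_reflect`). -/
theorem stub_reflect_divFree :
    ∀ v : EuclideanSpace ℝ (Fin 3) → EuclideanSpace ℝ (Fin 3),
      Literature.Analysis.FluidPDE.VectorCalculus.IsDivFree v →
      Literature.Analysis.FluidPDE.VectorCalculus.IsDivFree (fun x => -v (-x)) := by
  intro v hv x
  rw [divergence_reflect v x]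
  exact hv (-x)

end Summit.NavierStokesRegularity.NavierStokesRegularity.Theorems
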